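import Summits.QuantumFields.YangMills.Theorems.BalabanUVNodesN20BlockCaricatureAffinity
import Summits.QuantumFields.YangMills.Theorems.BalabanUVNodesN19NoDialRescuesLawSeparated

/-!
# BalabanUVNodes ∕ N20·N19′·N21 — THE λ-DICHOTOMY OF THE INDEPENDENT-BLOCK CARICATURE, KERNEL FORM (FILE B): in the caricature the two runs' class laws are
# LAW-SEPARATED (the hypothesis of dag-n19-w4's `no_dial_rescues`) iff ONE statistic `Λ_K ≍ λ_K = n_K (q_K − p_K)² ∕ (p_K + q_K)` does NOT tend to `0` —
# two-sided: `1 − e^{−Λ_K∕4} ≤ TV_K ≤ √Λ_K`; hence `∃ᶠ K, λ₀ ≤ Λ_K` ⇒ NO `Bad ∕ W ∕ shA ∕ shB ∕ Wsh ∕ δ` serves the three faces of K3⁷ stub 2 on the caricature carriers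

Cell `pub-ymgap` (HUMAN RULING D-0062 Track A; work-bound push D-0149, director-ym №197), width seat `pub-ymgap-dag-n20-w1` (gen 5) on node N20 = NE7b; key item K3⁷
`SpineGivenEndpointR13SepCoPH` = stmt-QuantumFields-20544 (`--kind proof --supports 20544 --as helper`); COUNT-NEUTRAL.  Bus: CLAIM-8 ∕ INTENT-12, FILE B (INBOX l.30022; split DECL-DELTA-12 l.30446).
THEOREMS ONLY: no `def`, no `instance`, no `notation`, no `sorry`; imports this seat's FILE A `…N20BlockCaricatureAffinity` (§1–§3: `exists_subset_one_sub_affinity_le`,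
`abs_sub_le_sqrt_one_sub_affinity_sq`, `affinity_config_eq_pow`, `stat_div_four_le_one_sub_affinity₁`, `one_sub_affinity₁_le_stat_div_two`, …) and dag-n19-w4's
`…N19NoDialRescuesLawSeparated` (`no_dial_rescues`, CONSUMED BY NAME in §5).

WHY (FILE A's header has the setting in full).  CRIT-1's triage of `window-key-core` ed. 2, Rec. (b) («cdisprove ∕ dag-n20»): «the cheapest falsifier is now ONE statistic —
TV-separation of the level-1 large-field block-COUNT laws … (`λ_K = n_K(q_K − p_K)²∕(p_K + q_K)` bounded or not); `λ_K → 0` voids (N); `λ_K → ∞` gives H of item 4 modulo block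
independence».  In the caricature (at step `K`: `n_K` independent level-1 blocks, large-field with probability `p_K` under run A, `q_K` under run B; classes = configurations
`S ⊆ range n_K`, carriers `T K = (range n_K).powerset`, class weights `p_K^{#S}(1−p_K)^{n_K−#S}` ∕ `q_K^{#S}(1−q_K)^{n_K−#S}`, totals `1`) THIS FILE makes that sentence a
two-sided KERNEL theorem with the symmetric letter `Λ := n·(q − p)²·(1∕(p + q) + 1∕(2 − p − q))` (`λ ≤ Λ`; `Λ ≤ 2λ` when `p + q ≤ 1`, FILE A §3):
  `1 − e^{−Λ_K∕4} ≤ sup_𝒮 (μ_B(𝒮) − μ_A(𝒮)) ≤ √Λ_K`  (§4),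
so the caricature's laws are `s`-separated for SOME `s > 0` — dag-n19-w4's `hsep` shape VERBATIM — IFF `Λ_K ↛ 0` (★★★ `lawSeparated_caricature_iff_not_tendsto`).  This REFINES the
critic's «bounded or not» to «NULL or not»: a bounded-but-not-null `λ_K` still separates (`s = 1 − e^{−λ₀∕4}` along the subsequence), `λ_K → ∞` separates at EVERY `s < 1`
(TV → 1), and only `Λ_K → 0` merges the laws — the CLT scale `q_K − p_K = o(√((p_K + q_K)∕n_K))` of the card's weakened (XG′) is exactly the merge regime.
* §4 one step, `n` blocks [folklore]: `one_sub_affinity_pow_le_stat` (`1 − u^{2n} ≤ Λ`, Bernoulli's inequality) · ★★ `abs_sub_config_le_sqrt_stat` (EVERY class set: `|μ_B − μ_A| ≤ √Λ`) · ★★ `exists_config_sep_ge` (SOME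
  class set: `μ_B − μ_A ≥ 1 − e^{−Λ∕4}`; `1 + x ≤ eˣ`).
* §5 along `K` (the statistic DISPLAYED as a letter `Λ` with its defining row `hΛ`) [folklore ∕ bookkeeping]: ★★ `lawSeparated_caricature_of_frequently_le` (`∃ᶠ K, λ₀ ≤ Λ_K` ⇒
  dag-n19-w4's `hsep` shape on the caricature carriers with `s := 1 − e^{−λ₀∕4}`, `t := 0`, every `l₀ ≥ 0`) · `lawSeparated_caricature_of_tendsto_atTop` (`Λ_K → ∞` ⇒ separated
  at EVERY `s < 1`) · ★★ `not_lawSeparated_caricature_of_tendsto_zero` (`Λ_K → 0` ⇒ no `s > 0` separates) · ★★★ `lawSeparated_caricature_iff_not_tendsto` ·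
  ★ `no_dial_rescues_caricature` (n19-w4 BY NAME: `∃ᶠ K, λ₀ ≤ Λ_K` ⇒ ¬ ∃ `Bad W shA shB Wsh δ`, `RelWeightBound ∧ ShellWeightBound ∧ (Core ∧ Summable δ)` on the caricature
  carriers, any `vol`) · `lawSeparated_caricature_of_frequently_le_stat` (the same from CRIT-1's one-sided `λ`) · `statSym_le_two_stat` (`Λ_K ≤ 2λ_K` when `p_K + q_K ≤ 1`).

HONEST FRAMING.  [folklore] finite-sum probability on a CARICATURE — independent blocks and product Bernoulli class weights are the card's simplification, NOT the record's
`classSet₁₃ ∕ weightA₁₃ ∕ weightB₁₃` (untouched); whether the record's block laws are independent, and what `p_K, q_K, n_K` are there, is NOT read here; (LS) AT THE RECORD, (XG′),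
(SAT′) remain UNDECIDED; proves NO estimate of Bałaban's; refutes NO registered stub (§5's negative statement is about the caricature carriers, not about `crOfRecord₁₃V`); nothing of
Bałaban's asserted or instantiated.  NE7 ∕ NE7b ∕ NE7c NOT PRINTED for `d = 4`, NOT proved; N19 ∕ N20 ∕ N21 NOT discharged; K3⁷ OPEN, skeleton v5 941dddb108cbaacf STANDS; counts
unmoved (typed 28∕28 · discharged 5∕27); no count claim.  One finite `𝕋⁴_{L^K}` programme at fixed `ε = L^{−K}`, Bałaban AS PRINTED; the YM mass gap (Clay) is NOT proved by any of
this — R4 closes the conditional finite-𝕋⁴ rung `BalabanLadder.UV` only; NOT ℝ⁴, NOT OS.  Sources (bookkeeping only): [Balaban1988Convergent] (1.1) p.244, (2.18) p.257;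
[Balaban1989LargeFieldII] (1.80) p.384.  No decl carries a cite tag.
-/

set_option autoImplicit false

noncomputable section

open Finset Filter Topology
open Literature.MathematicalPhysics.QuantumFieldTheory.Balaban1983to89
open Literature.MathematicalPhysics.QuantumFieldTheory.Balaban1983to89.T4WeightBudget
open Literature.MathematicalPhysics.QuantumFieldTheory.Balaban1983to89.T4IndicatorShell
open Summit.QuantumFields.BalabanUV.T4Continuum.Spine.NE7
open Summit.QuantumFields.YangMills.BalabanUVNodes.N19NoDialRescuesLawSeparated (no_dial_rescues)
open Summit.QuantumFields.YangMills.BalabanUVNodes.N20BlockCaricatureAffinity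

namespace Summit.QuantumFields.YangMills.BalabanUVNodes.N20BlockCaricatureLawSeparation

/-! ## §4 One step with `n` independent blocks: the two-sided bound on the class-law separation -/

section OneStep

variable {p q : ℝ}

/-- **THE AFFINITY-POWER DEFECT IS AT MOST THE STATISTIC**: `1 − u^{2n} ≤ 2n(1 − u) ≤ n·Λ₁ = Λ` (Bernoulli's inequality on `u^{2n} = (1 + (u − 1))^{2n}`, `u ≥ 0`, and FILE A's
`1 − u ≤ Λ₁∕2`).  So `√(1 − BC²) ≤ √Λ` for the caricature's affinity `BC = u^n`. [folklore] -/
theorem one_sub_affinity_pow_le_stat (hp0 : 0 ≤ p) (hq0 : 0 ≤ q) (hp1 : p ≤ 1) (hq1 : q ≤ 1) (n : ℕ) :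
    1 - (Real.sqrt (p * q) + Real.sqrt ((1 - p) * (1 - q))) ^ (n * 2) ≤ n * ((q - p) ^ 2 / (p + q) + (q - p) ^ 2 / (2 - p - q)) := by
  set u := Real.sqrt (p * q) + Real.sqrt ((1 - p) * (1 - q)) with hu
  have hB := one_add_mul_le_pow (show (-2 : ℝ) ≤ u - 1 by linarith [affinity₁_nonneg p q]) (n * 2)
  rw [add_sub_cancel] at hB
  have hdef := one_sub_affinity₁_le_stat_div_two hp0 hq0 hp1 hq1
  rw [← hu] at hdef
  have hn : (0 : ℝ) ≤ n := Nat.cast_nonneg n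
  push_cast at hB
  nlinarith

/-- ★★ **EVERY CLASS SET: `|μ_B(𝒮) − μ_A(𝒮)| ≤ √Λ`**, `Λ = n·Λ₁` [folklore].  Chain: `TV ≤ √(1 − u^{2n})` (FILE A §1 at `BC = u^n`, §2) and `one_sub_affinity_pow_le_stat`.
This is the MERGE side: `Λ_K → 0` forces the laws together at rate `√Λ_K`. -/
theorem abs_sub_config_le_sqrt_stat (hp0 : 0 ≤ p) (hq0 : 0 ≤ q) (hp1 : p ≤ 1) (hq1 : q ≤ 1) (n : ℕ)
    {𝒮 : Finset (Finset ℕ)} (h𝒮 : 𝒮 ⊆ (Finset.range n).powerset) :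
    |∑ S ∈ 𝒮, q ^ S.card * (1 - q) ^ (n - S.card) - ∑ S ∈ 𝒮, p ^ S.card * (1 - p) ^ (n - S.card)| ≤
      Real.sqrt (n * ((q - p) ^ 2 / (p + q) + (q - p) ^ 2 / (2 - p - q))) := by
  have h := abs_sub_le_sqrt_one_sub_affinity_sq (Finset.range n).powerset
    (a := fun S => p ^ S.card * (1 - p) ^ (n - S.card)) (b := fun S => q ^ S.card * (1 - q) ^ (n - S.card))
    (fun S _ => config_nonneg hp0 hp1 n S) (fun S _ => config_nonneg hq0 hq1 n S) (sum_config_eq_one p n) (sum_config_eq_one q n) h𝒮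
  refine h.trans (Real.sqrt_le_sqrt ?_)
  rw [affinity_config_eq_pow hp0 hq0 hp1 hq1 n, ← pow_mul]
  exact one_sub_affinity_pow_le_stat hp0 hq0 hp1 hq1 n

/-- ★★ **SOME CLASS SET: `μ_B(𝒮) − μ_A(𝒮) ≥ 1 − e^{−Λ∕4}`** [folklore].  Chain: `TV ≥ 1 − u^n` (§1 at `BC = u^n`, witnessed by the configurations likelier under run B)
and `u ≤ 1 − Λ₁∕4 ≤ e^{−Λ₁∕4}` (§3, `1 + x ≤ eˣ`).  This is the SEPARATION side: `Λ_K ≥ η₀` infinitely often makes the laws `(1 − e^{−η₀∕4})`-separated. -/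
theorem exists_config_sep_ge (hp0 : 0 ≤ p) (hq0 : 0 ≤ q) (hp1 : p ≤ 1) (hq1 : q ≤ 1) (n : ℕ) :
    ∃ 𝒮, 𝒮 ⊆ (Finset.range n).powerset ∧
      1 - Real.exp (-(n * ((q - p) ^ 2 / (p + q) + (q - p) ^ 2 / (2 - p - q))) / 4) ≤
        ∑ S ∈ 𝒮, q ^ S.card * (1 - q) ^ (n - S.card) - ∑ S ∈ 𝒮, p ^ S.card * (1 - p) ^ (n - S.card) := by
  obtain ⟨𝒮, h𝒮, hle⟩ := exists_subset_one_sub_affinity_le (Finset.range n).powerset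
    (a := fun S => p ^ S.card * (1 - p) ^ (n - S.card)) (b := fun S => q ^ S.card * (1 - q) ^ (n - S.card))
    (fun S _ => config_nonneg hp0 hp1 n S) (fun S _ => config_nonneg hq0 hq1 n S) (sum_config_eq_one q n)
  refine ⟨𝒮, h𝒮, le_trans ?_ hle⟩
  rw [affinity_config_eq_pow hp0 hq0 hp1 hq1 n]
  set u := Real.sqrt (p * q) + Real.sqrt ((1 - p) * (1 - q)) with hu
  set L := (q - p) ^ 2 / (p + q) + (q - p) ^ 2 / (2 - p - q) with hL
  have hdef := stat_div_four_le_one_sub_affinity₁ hp0 hq0 hp1 hq1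
  rw [← hu, ← hL] at hdef
  have hu0 : 0 ≤ u := affinity₁_nonneg p q
  -- `u^n ≤ (1 − L∕4)^n ≤ (e^{−L∕4})^n = e^{−nL∕4}`
  have h1 : u ^ n ≤ (1 - L / 4) ^ n := pow_le_pow_left₀ hu0 (by linarith) n
  have h2 : (1 - L / 4) ^ n ≤ Real.exp (-(L / 4)) ^ n :=
    pow_le_pow_left₀ (by linarith) (by linarith [Real.add_one_le_exp (-(L / 4))]) n
  have h3 : Real.exp (-(L / 4)) ^ n = Real.exp (-(n * L) / 4) := by
    rw [← Real.exp_nat_mul]; congr 1; ring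
  linarith

end OneStep

/-! ## §5 Along the scales `K`: law separation of the caricature ⟺ the statistic does not tend to `0`; `no_dial_rescues` by name -/

section AlongK

variable (n : ℕ → ℕ) (p q : ℕ → ℝ) (Λ : ℕ → ℝ)

/-- ★★ **SEPARATION FROM A NON-NULL STATISTIC** — dag-n19-w4's `hsep` shape VERBATIM on the caricature carriers [folklore ∕ bookkeeping]: if `η₀ ≤ Λ_K` for infinitely many `K`
(`η₀ > 0`), then for every `K₀` some `K ≥ K₀`, `|t| ≤ l₀` (here `t = 0`) and SOME set of configurations `𝒮` carry normalised run-B mass minus run-A mass `≥ 1 − e^{−η₀∕4}`. -/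
theorem lawSeparated_caricature_of_frequently_le (hp : ∀ K, 0 ≤ p K ∧ p K ≤ 1) (hq : ∀ K, 0 ≤ q K ∧ q K ≤ 1)
    (hΛ : ∀ K, Λ K = n K * ((q K - p K) ^ 2 / (p K + q K) + (q K - p K) ^ 2 / (2 - p K - q K)))
    {l₀ η₀ : ℝ} (hl₀ : 0 ≤ l₀) (hfreq : ∃ᶠ K in atTop, η₀ ≤ Λ K) :
    ∀ K₀ : ℕ, ∃ K, K₀ ≤ K ∧ ∃ t : ℝ, |t| ≤ l₀ ∧ ∃ 𝒮, 𝒮 ⊆ (Finset.range (n K)).powerset ∧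
      1 - Real.exp (-η₀ / 4) ≤
        (∑ S ∈ 𝒮, q K ^ S.card * (1 - q K) ^ (n K - S.card)) / (∑ S ∈ (Finset.range (n K)).powerset, q K ^ S.card * (1 - q K) ^ (n K - S.card)) -
        (∑ S ∈ 𝒮, p K ^ S.card * (1 - p K) ^ (n K - S.card)) / (∑ S ∈ (Finset.range (n K)).powerset, p K ^ S.card * (1 - p K) ^ (n K - S.card)) := by
  intro K₀
  obtain ⟨K, hK, hKlam⟩ := frequently_atTop.1 hfreq K₀
  obtain ⟨𝒮, h𝒮, hsep⟩ := exists_config_sep_ge (hp K).1 (hq K).1 (hp K).2 (hq K).2 (n K)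
  refine ⟨K, hK, 0, by simpa using hl₀, 𝒮, h𝒮, ?_⟩
  rw [sum_config_eq_one, sum_config_eq_one, div_one, div_one]
  refine le_trans ?_ hsep
  rw [← hΛ K]
  have : Real.exp (-Λ K / 4) ≤ Real.exp (-η₀ / 4) := Real.exp_le_exp.2 (by linarith)
  linarith

/-- `Λ_K → ∞` (the critic's «λ_K → ∞ gives H») ⇒ the caricature's laws are separated at EVERY level `s < 1`: the total variation tends to `1`. [folklore ∕ bookkeeping] -/
theorem lawSeparated_caricature_of_tendsto_atTop (hp : ∀ K, 0 ≤ p K ∧ p K ≤ 1) (hq : ∀ K, 0 ≤ q K ∧ q K ≤ 1)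
    (hΛ : ∀ K, Λ K = n K * ((q K - p K) ^ 2 / (p K + q K) + (q K - p K) ^ 2 / (2 - p K - q K)))
    {l₀ s : ℝ} (hl₀ : 0 ≤ l₀) (hs : s < 1) (htop : Tendsto Λ atTop atTop) :
    ∀ K₀ : ℕ, ∃ K, K₀ ≤ K ∧ ∃ t : ℝ, |t| ≤ l₀ ∧ ∃ 𝒮, 𝒮 ⊆ (Finset.range (n K)).powerset ∧
      s ≤ (∑ S ∈ 𝒮, q K ^ S.card * (1 - q K) ^ (n K - S.card)) / (∑ S ∈ (Finset.range (n K)).powerset, q K ^ S.card * (1 - q K) ^ (n K - S.card)) -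
        (∑ S ∈ 𝒮, p K ^ S.card * (1 - p K) ^ (n K - S.card)) / (∑ S ∈ (Finset.range (n K)).powerset, p K ^ S.card * (1 - p K) ^ (n K - S.card)) := by
  -- pick `η₀ > 0` with `1 − e^{−η₀∕4} ≥ s`: any `η₀` with `e^{−η₀∕4} ≤ 1 − s`, e.g. from `e^{−x} → 0`
  have h1s : 0 < 1 - s := by linarith
  obtain ⟨η₀, hη₀⟩ : ∃ η₀ : ℝ, 0 < η₀ ∧ Real.exp (-η₀ / 4) ≤ 1 - s := by
    refine ⟨max 1 (-4 * Real.log (1 - s)), lt_max_of_lt_left one_pos, ?_⟩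
    have : -max 1 (-4 * Real.log (1 - s)) / 4 ≤ Real.log (1 - s) := by
      have := le_max_right 1 (-4 * Real.log (1 - s)); linarith
    calc Real.exp (-max 1 (-4 * Real.log (1 - s)) / 4) ≤ Real.exp (Real.log (1 - s)) := Real.exp_le_exp.2 this
      _ = 1 - s := Real.exp_log h1s
  have hfreq : ∃ᶠ K in atTop, η₀ ≤ Λ K := (htop.eventually (eventually_ge_atTop η₀)).frequently
  intro K₀
  obtain ⟨K, hK, t, ht, 𝒮, h𝒮, h⟩ := lawSeparated_caricature_of_frequently_le n p q Λ hp hq hΛ hl₀ hfreq K₀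
  exact ⟨K, hK, t, ht, 𝒮, h𝒮, by linarith⟩

/-- ★★ **MERGE FROM A NULL STATISTIC** [folklore ∕ bookkeeping]: if `Λ_K → 0` then NO `s > 0` separates the caricature's class laws (any `l₀`): for large `K` every set of
configurations has `|μ_B − μ_A| ≤ √Λ_K < s` (§4).  This is the critic's «`λ_K → 0` voids (N)» as a theorem of the caricature. -/
theorem not_lawSeparated_caricature_of_tendsto_zero (hp : ∀ K, 0 ≤ p K ∧ p K ≤ 1) (hq : ∀ K, 0 ≤ q K ∧ q K ≤ 1)
    (hΛ : ∀ K, Λ K = n K * ((q K - p K) ^ 2 / (p K + q K) + (q K - p K) ^ 2 / (2 - p K - q K)))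
    (hlim : Tendsto Λ atTop (𝓝 0)) {l₀ s : ℝ} (hs : 0 < s) :
    ¬ ∀ K₀ : ℕ, ∃ K, K₀ ≤ K ∧ ∃ t : ℝ, |t| ≤ l₀ ∧ ∃ 𝒮, 𝒮 ⊆ (Finset.range (n K)).powerset ∧
      s ≤ (∑ S ∈ 𝒮, q K ^ S.card * (1 - q K) ^ (n K - S.card)) / (∑ S ∈ (Finset.range (n K)).powerset, q K ^ S.card * (1 - q K) ^ (n K - S.card)) -
        (∑ S ∈ 𝒮, p K ^ S.card * (1 - p K) ^ (n K - S.card)) / (∑ S ∈ (Finset.range (n K)).powerset, p K ^ S.card * (1 - p K) ^ (n K - S.card)) := by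
  intro hsep
  obtain ⟨K₀, hK₀⟩ := eventually_atTop.1 (hlim.eventually (gt_mem_nhds (sq_pos_of_pos hs)))
  obtain ⟨K, hK, t, -, 𝒮, h𝒮, hle⟩ := hsep K₀
  rw [sum_config_eq_one, sum_config_eq_one, div_one, div_one] at hle
  have hbound := abs_sub_config_le_sqrt_stat (hp K).1 (hq K).1 (hp K).2 (hq K).2 (n K) h𝒮
  rw [← hΛ K] at hbound
  have hΛ0 : 0 ≤ Λ K := by rw [hΛ K]; exact mul_nonneg (Nat.cast_nonneg _) (stat₁_nonneg (hp K).1 (hq K).1 (hp K).2 (hq K).2)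
  have hlt : Real.sqrt (Λ K) < s := by
    calc Real.sqrt (Λ K) < Real.sqrt (s ^ 2) := Real.sqrt_lt_sqrt hΛ0 (hK₀ K hK)
      _ = s := Real.sqrt_sq hs.le
  linarith [le_abs_self (∑ S ∈ 𝒮, q K ^ S.card * (1 - q K) ^ (n K - S.card) - ∑ S ∈ 𝒮, p K ^ S.card * (1 - p K) ^ (n K - S.card))]

/-- ★★★ **THE λ-DICHOTOMY OF THE CARICATURE** [folklore ∕ bookkeeping]: the caricature's class laws are LAW-SEPARATED for SOME `s > 0` (dag-n19-w4's `hsep` shape, any fixed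
`l₀ ≥ 0`) IF AND ONLY IF the statistic `Λ_K = n_K (q_K − p_K)² (1∕(p_K + q_K) + 1∕(2 − p_K − q_K))` does NOT tend to `0`.  The critic's «bounded or not» is thus sharpened to
«NULL or not»: bounded-away-from-zero along a subsequence already separates. -/
theorem lawSeparated_caricature_iff_not_tendsto (hp : ∀ K, 0 ≤ p K ∧ p K ≤ 1) (hq : ∀ K, 0 ≤ q K ∧ q K ≤ 1)
    (hΛ : ∀ K, Λ K = n K * ((q K - p K) ^ 2 / (p K + q K) + (q K - p K) ^ 2 / (2 - p K - q K)))
    {l₀ : ℝ} (hl₀ : 0 ≤ l₀) :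
    (∃ s : ℝ, 0 < s ∧ ∀ K₀ : ℕ, ∃ K, K₀ ≤ K ∧ ∃ t : ℝ, |t| ≤ l₀ ∧ ∃ 𝒮, 𝒮 ⊆ (Finset.range (n K)).powerset ∧
      s ≤ (∑ S ∈ 𝒮, q K ^ S.card * (1 - q K) ^ (n K - S.card)) / (∑ S ∈ (Finset.range (n K)).powerset, q K ^ S.card * (1 - q K) ^ (n K - S.card)) -
        (∑ S ∈ 𝒮, p K ^ S.card * (1 - p K) ^ (n K - S.card)) / (∑ S ∈ (Finset.range (n K)).powerset, p K ^ S.card * (1 - p K) ^ (n K - S.card))) ↔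
    ¬ Tendsto Λ atTop (𝓝 0) := by
  constructor
  · rintro ⟨s, hs, hsep⟩ hlim
    exact not_lawSeparated_caricature_of_tendsto_zero n p q Λ hp hq hΛ hlim hs hsep
  · intro hnot
    -- `¬ Λ_K → 0` with `Λ ≥ 0` ⇒ some `ε > 0` is undershot only finitely often: `∃ᶠ K, ε ≤ Λ K`
    have hΛ0 : ∀ K, 0 ≤ Λ K := fun K => by
      rw [hΛ K]; exact mul_nonneg (Nat.cast_nonneg _) (stat₁_nonneg (hp K).1 (hq K).1 (hp K).2 (hq K).2)
    obtain ⟨ε, hε, hfreq⟩ : ∃ ε : ℝ, 0 < ε ∧ ∃ᶠ K in atTop, ε ≤ Λ K := by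
      by_contra hcon
      refine hnot (Metric.tendsto_atTop.2 fun ε hε => ?_)
      have hnf : ¬ ∃ᶠ K in atTop, ε ≤ Λ K := fun h => hcon ⟨ε, hε, h⟩
      obtain ⟨N, hN⟩ := eventually_atTop.1 (not_frequently.1 hnf)
      exact ⟨N, fun K hK => by rw [Real.dist_eq, sub_zero, abs_of_nonneg (hΛ0 K)]; exact not_le.1 (hN K hK)⟩
    refine ⟨1 - Real.exp (-ε / 4), ?_, lawSeparated_caricature_of_frequently_le n p q Λ hp hq hΛ hl₀ hfreq⟩
    have : Real.exp (-ε / 4) < Real.exp 0 := Real.exp_lt_exp.2 (by linarith)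
    rw [Real.exp_zero] at this
    linarith

/-- ★ **NO DIAL RESCUES THE CARICATURE FROM A NON-NULL STATISTIC** — dag-n19-w4's `no_dial_rescues` BY NAME [folklore ∕ bookkeeping]: if `η₀ ≤ Λ_K` infinitely often (`η₀ > 0`),
then on the caricature carriers (`T K = (range n_K).powerset`, product Bernoulli class weights, any source window `l₀ ≥ 0`, any `vol`) NO bad-class family `Bad`, NO weights `W`,
NO shells `shA, shB`, NO shell weights `Wsh` and NO widths `δ` give the three faces of K3⁷ stub 2 together. -/
theorem no_dial_rescues_caricature (hp : ∀ K, 0 ≤ p K ∧ p K ≤ 1) (hq : ∀ K, 0 ≤ q K ∧ q K ≤ 1)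
    (hΛ : ∀ K, Λ K = n K * ((q K - p K) ^ 2 / (p K + q K) + (q K - p K) ^ 2 / (2 - p K - q K)))
    {l₀ η₀ : ℝ} (hl₀ : 0 ≤ l₀) (hη₀ : 0 < η₀) (hfreq : ∃ᶠ K in atTop, η₀ ≤ Λ K) (vol : ℝ) :
    ¬ ∃ (Bad : ℕ → ℝ → Finset (Finset ℕ)) (W : ℕ → ℝ) (shA shB : ℕ → ℝ → Finset ℕ → ℝ) (Wsh δ : ℕ → ℝ),
      RelWeightBound l₀ (fun K => (Finset.range (n K)).powerset) (fun K _ S => p K ^ S.card * (1 - p K) ^ (n K - S.card))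
        (fun K _ S => q K ^ S.card * (1 - q K) ^ (n K - S.card)) Bad W ∧
      ShellWeightBound l₀ (fun K => (Finset.range (n K)).powerset) (fun K _ S => p K ^ S.card * (1 - p K) ^ (n K - S.card))
        (fun K _ S => q K ^ S.card * (1 - q K) ^ (n K - S.card)) shA shB Wsh ∧
      (Core l₀ vol (fun K => (Finset.range (n K)).powerset) Bad (fun K t S => p K ^ S.card * (1 - p K) ^ (n K - S.card) - shA K t S)
        (fun K t S => q K ^ S.card * (1 - q K) ^ (n K - S.card) - shB K t S) δ ∧ Summable δ) := by
  have hs : 0 < 1 - Real.exp (-η₀ / 4) := by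
    have : Real.exp (-η₀ / 4) < Real.exp 0 := Real.exp_lt_exp.2 (by linarith)
    rw [Real.exp_zero] at this
    linarith
  exact no_dial_rescues (vol := vol) hs (lawSeparated_caricature_of_frequently_le n p q Λ hp hq hΛ hl₀ hfreq)
    (fun K t _ => by rw [sum_config_eq_one]; exact one_pos)

/-- The same separation from CRIT-1's one-sided letter `λ_K = n_K (q_K − p_K)²∕(p_K + q_K) ≤ Λ_K`: `∃ᶠ K, η₀ ≤ λ_K` suffices. [folklore ∕ bookkeeping] -/
theorem lawSeparated_caricature_of_frequently_le_stat (hp : ∀ K, 0 ≤ p K ∧ p K ≤ 1) (hq : ∀ K, 0 ≤ q K ∧ q K ≤ 1)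
    (hΛ : ∀ K, Λ K = n K * ((q K - p K) ^ 2 / (p K + q K) + (q K - p K) ^ 2 / (2 - p K - q K)))
    {l₀ η₀ : ℝ} (hl₀ : 0 ≤ l₀) (hfreq : ∃ᶠ K in atTop, η₀ ≤ n K * ((q K - p K) ^ 2 / (p K + q K))) :
    ∀ K₀ : ℕ, ∃ K, K₀ ≤ K ∧ ∃ t : ℝ, |t| ≤ l₀ ∧ ∃ 𝒮, 𝒮 ⊆ (Finset.range (n K)).powerset ∧
      1 - Real.exp (-η₀ / 4) ≤
        (∑ S ∈ 𝒮, q K ^ S.card * (1 - q K) ^ (n K - S.card)) / (∑ S ∈ (Finset.range (n K)).powerset, q K ^ S.card * (1 - q K) ^ (n K - S.card)) -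
        (∑ S ∈ 𝒮, p K ^ S.card * (1 - p K) ^ (n K - S.card)) / (∑ S ∈ (Finset.range (n K)).powerset, p K ^ S.card * (1 - p K) ^ (n K - S.card)) :=
  lawSeparated_caricature_of_frequently_le n p q Λ hp hq hΛ hl₀ (hfreq.mono fun K hK => hK.trans (by
    rw [hΛ K]; exact mul_le_mul_of_nonneg_left (stat₁_le_statSym₁ (hp K).2 (hq K).2) (Nat.cast_nonneg _)))

/-- In the rare-event regime `p_K + q_K ≤ 1` the two letters are equivalent: `Λ_K ≤ 2 λ_K`, so `λ_K → 0` there gives `Λ_K → 0` and the MERGE. [folklore ∕ bookkeeping] -/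
theorem statSym_le_two_stat (hp : ∀ K, 0 ≤ p K ∧ p K ≤ 1) (hq : ∀ K, 0 ≤ q K ∧ q K ≤ 1)
    (hΛ : ∀ K, Λ K = n K * ((q K - p K) ^ 2 / (p K + q K) + (q K - p K) ^ 2 / (2 - p K - q K)))
    (K : ℕ) (hpq : p K + q K ≤ 1) : Λ K ≤ 2 * (n K * ((q K - p K) ^ 2 / (p K + q K))) := by
  rw [hΛ K, mul_left_comm]
  exact mul_le_mul_of_nonneg_left (statSym₁_le_two_stat₁ (hp K).1 (hq K).1 hpq) (Nat.cast_nonneg _)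

end AlongK

end Summit.QuantumFields.YangMills.BalabanUVNodes.N20BlockCaricatureLawSeparation

end
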